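import Mathlib
import HarnessLib
import Summits.HubbardSuperconductivity.HubbardSuperconductivity.Theorems.KLProgrammeKLRegimeWickBubbleChannelPHGeneral
import Summits.HubbardSuperconductivity.HubbardSuperconductivity.Theorems.KLProgrammeKLRegimeWickBubbleChannels

/-!
# Route `KLProgramme` — crux K3, ENGINE child (gen 5 stmt-…-19918 / gen 6 stmt-…-20236 `KLRegimeEngineV16`), stub `stub_engine_step_values`,
# conjunct (E2-v10) at `1 ≤ n`: the THREE-CHANNEL READING at general external pair frequencies, for ANY conserving carrier —
# `vertexFn_dblFold_bubble_pairKernel_of_conserving`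

Cell gate-hubbard-kl, seat hubbard-kl-k3c1-p1 (g6), technique «composed-map remainder propagation».  Third of the general-frequency / generic-carrier
ports (after `…WickBubbleChannelPPGeneral` p510766 and `…WickBubbleChannelPHGeneral`).  p1 g9's assembled identity `vertexFn_dblFold_bubble_pairLabels`
(`…WickBubbleChannels`) reads `𝒱₄(dblFold(Δ_×(C₁)Δ_×(C₂)(𝒲⁰·𝒲¹)))` at the pair labels with both external pairs at `ω₀` and `𝒲 = klWickAction … n`.
The continuous (E2) organisation reads the `k = 1` class of its source `dblFold(Δ_×(Ċ_Λ)(e^{Δ_×(D_Λ)}(𝒲_Λ⁰·𝒲_Λ¹)))` (`…WickScaleFlowSource`,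
p511554) at EVERY pair of external frequencies and for the real-cutoff carrier.  Here, for any `W` obeying the four conservation selection rules:

* §1 two-leg selection FROM the four rules: `kernel_two_plus/minus_eq_zero_of_conserving` (the `hplus`/`hminus` hypotheses of k3c2-p3's
  `vertexFn_dblFold_oneLine_of_twoLeg`, p509396, discharged for every conserving carrier);
* §2 `bubbleSum_sixTwo_of_twoLeg` — p1's `𝒲₆⊗𝒲₂` colouring sum for any `W` with two-leg selection (legs arbitrary, as in p1):
  `= 2·(c₆c₂)⁻¹·Σ_{p,σ} ℓ₁(p)ℓ₂(p)·𝒱₆(W)(ψ̂⁺_{pσ}, ψ̂⁻_{pσ}, Z)·Σ_W(p,σ)`, `Σ_W = selfEnergy … W`;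
* §3 **`vertexFn_dblFold_bubble_pairKernel_of_conserving`** — at the pair labels `Z(x,y) = ((ω′,k⃗′)↑+, (−ω′,Q−k⃗′)↓+, (−ω,Q−k⃗)↓−, (ω,k⃗)↑−)`:
  `𝒱₄(dblFold(Δ_×(C₁)Δ_×(C₂)(W⁰·W¹)))(Z) = 2·(βL²)⁻³·(PP + PHd − PHx − 2·S62)` with the general-frequency channel sums of the two previous files
  (`PP` on the frequency-resolved pair kernel of `W`, `PHd` / `PHx` conditional loop sums at transfers `(ω−ω′, k⃗−k⃗′)` / `(ω+ω′+…, k⃗+k⃗′−Q)`);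
* §4 instances: `vertexFn_dblFold_bubble_pairKernel_klWickAction` (grid carrier, general frequencies), **`vertexFn_dblFold_bubble_pairKernel_wickActionR`**
  (real cutoff; with `(C₁, C₂) = (Ċ_Λ, D_Λ)` from `…WickScaleFlowLines` this is the two-line class of the within-slice source).

Proofs are p1 g9's with frequencies made variables and the carrier abstracted; exact identities; nothing about sizes or physics.  0 kit.
-/

noncomputable section

namespace Summit.HubbardSuperconductivity.HubbardSuperconductivity.Theorems.KLRegimeWick

set_option linter.dupNamespace false -- summit = problem name (single-conjunct summit), D-0017

open Literature.MathematicalPhysics.QuantumLattice GrassmannAlgebra Finset Matrix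
open Literature.Probability.LatticeModels
open Summit.HubbardSuperconductivity.HubbardSuperconductivity.Theorems.TwoPointAssembly
open Summit.HubbardSuperconductivity.HubbardSuperconductivity.Theorems.KLProgrammeLegKernels
open Summit.HubbardSuperconductivity.HubbardSuperconductivity.Theorems.KLRegimeSplit

section Generic

variable {L M : ℕ} [NeZero L] [NeZero M] (β : ℝ) (W : HubbardGrassmann L M)

/-! ## §1 Two-leg selection from the four conservation rules -/

omit [NeZero L] [NeZero M] in
/-- **Two-leg kernels of a conserving carrier pair only reciprocal labels** (`ψ̂⁺` first). -/
theorem kernel_two_plus_eq_zero_of_conserving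
    (hWq : ∀ (m : ℕ) (X : Fin m → HubbardFieldIdx L M), (∑ i, (if (X i).2 = 0 then (1 : ℤ) else -1)) ≠ 0 → kernel ℂ W m X = 0)
    (hWf : ∀ (m : ℕ) (X : Fin m → HubbardFieldIdx L M),
      (∑ i, (if (X i).2 = 0 then (1 : ℤ) else -1) * matsubaraInt M (X i).1.1.1) ≠ 0 → kernel ℂ W m X = 0)
    (hWs : ∀ (m : ℕ) (X : Fin m → HubbardFieldIdx L M),
      (∑ i, (if (X i).2 = 0 then (1 : ℤ) else -1) * (if (X i).1.2 = 0 then 1 else 0)) ≠ 0 → kernel ℂ W m X = 0)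
    (hWp : ∀ (m : ℕ) (X : Fin m → HubbardFieldIdx L M) (j : Fin 2),
      (∑ i, (if (X i).2 = 0 then (1 : ℤ) else -1) • (X i).1.1.2 j) ≠ 0 → kernel ℂ W m X = 0)
    (p : FreqMomentum L M) (σ : Fin 2) {Y' : HubbardFieldIdx L M} (hY : Y' ≠ ((p, σ), 1)) : kernel ℂ W 2 ![((p, σ), 0), Y'] = 0 := by
  rcases Y' with ⟨⟨p', σ'⟩, c'⟩
  by_cases hc : c' = 1
  · subst hc
    by_cases hσ : σ' = σ
    · subst hσ
      by_cases hf : p'.1 = p.1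
      · have hm : p'.2 ≠ p.2 := fun h2 => hY (by rw [show p' = p from Prod.ext hf h2])
        have : ∃ j : Fin 2, p'.2 j ≠ p.2 j := by
          by_contra hall
          push Not at hall
          exact hm (funext hall)
        obtain ⟨j, hj⟩ := this
        refine hWp 2 _ j ?_
        simp only [Fin.sum_univ_two, Matrix.cons_val_zero, Matrix.cons_val_one, Fin.isValue, if_true, one_ne_zero, if_false,
          one_smul, neg_smul]
        intro h0
        apply hj
        linear_combination -h0
      · refine hWf 2 _ ?_
        simp only [Fin.sum_univ_two, Matrix.cons_val_zero, Matrix.cons_val_one, Fin.isValue, if_true, one_ne_zero, if_false,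
          one_mul, neg_mul]
        intro h0
        apply hf
        apply matsubaraInt_injective M
        linarith
    · refine hWs 2 _ ?_
      fin_cases σ <;> fin_cases σ'
      · exact absurd rfl hσ
      · simp [Fin.sum_univ_two]
      · simp [Fin.sum_univ_two]
      · exact absurd rfl hσ
  · obtain rfl : c' = 0 := by
      rcases Fin.exists_fin_two.mp ⟨c', rfl⟩ with h | h
      · exact h
      · exact absurd h hc
    refine hWq 2 _ ?_
    simp [Fin.sum_univ_two]

omit [NeZero L] [NeZero M] in
/-- … and (`ψ̂⁻` first). -/
theorem kernel_two_minus_eq_zero_of_conserving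
    (hWq : ∀ (m : ℕ) (X : Fin m → HubbardFieldIdx L M), (∑ i, (if (X i).2 = 0 then (1 : ℤ) else -1)) ≠ 0 → kernel ℂ W m X = 0)
    (hWf : ∀ (m : ℕ) (X : Fin m → HubbardFieldIdx L M),
      (∑ i, (if (X i).2 = 0 then (1 : ℤ) else -1) * matsubaraInt M (X i).1.1.1) ≠ 0 → kernel ℂ W m X = 0)
    (hWs : ∀ (m : ℕ) (X : Fin m → HubbardFieldIdx L M),
      (∑ i, (if (X i).2 = 0 then (1 : ℤ) else -1) * (if (X i).1.2 = 0 then 1 else 0)) ≠ 0 → kernel ℂ W m X = 0)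
    (hWp : ∀ (m : ℕ) (X : Fin m → HubbardFieldIdx L M) (j : Fin 2),
      (∑ i, (if (X i).2 = 0 then (1 : ℤ) else -1) • (X i).1.1.2 j) ≠ 0 → kernel ℂ W m X = 0)
    (p : FreqMomentum L M) (σ : Fin 2) {Y' : HubbardFieldIdx L M} (hY : Y' ≠ ((p, σ), 0)) : kernel ℂ W 2 ![((p, σ), 1), Y'] = 0 := by
  rcases Y' with ⟨⟨p', σ'⟩, c'⟩
  by_cases hc : c' = 0
  · subst hc
    have h2 : (![((p', σ'), (0 : Fin 2)), ((p, σ), 1)] : Fin 2 → HubbardFieldIdx L M) = ![((p, σ), 1), ((p', σ'), 0)] ∘ Equiv.swap (0 : Fin 2) 1 := by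
      funext i; fin_cases i <;> rfl
    have h := kernel_two_plus_eq_zero_of_conserving W hWq hWf hWs hWp p' σ' (Y' := ((p, σ), 1)) (fun h => hY (by
      simp only [Prod.mk.injEq] at h
      rw [h.1.1, h.1.2]))
    rw [h2, kernel_comp_perm, Equiv.Perm.sign_swap (by decide)] at h
    simpa using h
  · obtain rfl : c' = 1 := by
      rcases Fin.exists_fin_two.mp ⟨c', rfl⟩ with h | h
      · exact absurd h hc
      · exact h
    refine hWq 2 _ ?_
    simp [Fin.sum_univ_two]

/-! ## §2 The `W₆ ⊗ W₂` colouring sum for a carrier with two-leg selection -/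

omit [NeZero M] in
/-- **`bubbleSum_sixTwo_of_twoLeg`** — p1's `𝒲₆⊗𝒲₂` colouring sum at any four legs `Z`, for any `W` whose two-leg kernels pair only reciprocal
labels: `= 2·(c₆c₂)⁻¹·Σ_{p,σ} ℓ₁(p)ℓ₂(p)·𝒱₆(W)(ψ̂⁺_{pσ}, ψ̂⁻_{pσ}, Z)·Σ_W(p,σ)`, `Σ_W = selfEnergy … W`. -/
theorem bubbleSum_sixTwo_of_twoLeg (hβ : β ≠ 0)
    (hplus : ∀ (p : FreqMomentum L M) (σ : Fin 2) (Y' : HubbardFieldIdx L M), Y' ≠ ((p, σ), 1) → kernel ℂ W 2 ![((p, σ), 0), Y'] = 0)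
    (hminus : ∀ (p : FreqMomentum L M) (σ : Fin 2) (Y' : HubbardFieldIdx L M), Y' ≠ ((p, σ), 0) → kernel ℂ W 2 ![((p, σ), 1), Y'] = 0)
    {C₁ C₂ : Matrix (HubbardFieldIdx L M) (HubbardFieldIdx L M) ℂ} {ℓ₁ ℓ₂ : FreqMomentum L M → ℂ}
    (h₁ : contr ℂ C₁ = diagContr L M ℓ₁) (h₂ : contr ℂ C₂ = diagContr L M ℓ₂) (Z₀ Z₁ Z₂ Z₃ : HubbardFieldIdx L M) :
    ∑ X, ∑ Y, ∑ X', ∑ Y', contr ℂ C₂ X Y * contr ℂ C₁ X' Y' *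
        (kernel ℂ W 6 ![X, X', Z₀, Z₁, Z₂, Z₃] * kernel ℂ W 2 ![Y, Y']) =
      2 * ((((Nat.factorial 6 : ℝ) * (β * (L : ℝ) ^ 2) ^ 5 : ℝ) : ℂ)⁻¹ * (((Nat.factorial 2 : ℝ) * (β * (L : ℝ) ^ 2) ^ 1 : ℝ) : ℂ)⁻¹) *
        ∑ p : FreqMomentum L M, ∑ σ : Fin 2, ℓ₁ p * ℓ₂ p *
          (vertexFn L M β W 6 ![((p, σ), 0), ((p, σ), 1), Z₀, Z₁, Z₂, Z₃] * selfEnergy L M β W p σ) := by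
  -- Step 1: line reductions
  rw [h₁, h₂]
  simp_rw [mul_assoc, ← Finset.mul_sum]
  rw [sum_diagContr_mul]
  simp_rw [sum_diagContr_mul]
  -- Step 2: the two-leg kernel pairs only reciprocal labels: equal charges die …
  have hv0 : ∀ (p p' : FreqMomentum L M) (σ σ' : Fin 2), kernel ℂ W 2 ![((p, σ), 0), ((p', σ'), 0)] = 0 :=
    fun p p' σ σ' => hplus p σ _ (by simp)
  have hv1 : ∀ (p p' : FreqMomentum L M) (σ σ' : Fin 2), kernel ℂ W 2 ![((p, σ), 1), ((p', σ'), 1)] = 0 :=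
    fun p p' σ σ' => hminus p σ _ (by simp)
  simp only [hv0, hv1, mul_zero, sub_zero, zero_sub, mul_neg, Finset.sum_neg_distrib, Finset.mul_sum]
  -- … and the second line sits on the same `(p, σ)`
  have hc0 : ∀ (p : FreqMomentum L M) (σ : Fin 2) (g : FreqMomentum L M → Fin 2 → ℂ),
      ∑ p' : FreqMomentum L M, ∑ σ' : Fin 2, g p' σ' * kernel ℂ W 2 ![((p, σ), 0), ((p', σ'), 1)] =
        g p σ * kernel ℂ W 2 ![((p, σ), 0), ((p, σ), 1)] := by
    intro p σ g
    rw [← Fintype.sum_prod_type']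
    refine Finset.sum_eq_single (((p, σ)) : FreqMomentum L M × Fin 2) (fun q _ hq => ?_) (fun h => absurd (Finset.mem_univ _) h)
    obtain ⟨p', σ'⟩ := q
    dsimp only
    rw [hplus p σ _ (fun h => hq (by simpa using h)), mul_zero]
  have hc1 : ∀ (p : FreqMomentum L M) (σ : Fin 2) (g : FreqMomentum L M → Fin 2 → ℂ),
      ∑ p' : FreqMomentum L M, ∑ σ' : Fin 2, g p' σ' * kernel ℂ W 2 ![((p, σ), 1), ((p', σ'), 0)] =
        g p σ * kernel ℂ W 2 ![((p, σ), 1), ((p, σ), 0)] := by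
    intro p σ g
    rw [← Fintype.sum_prod_type']
    refine Finset.sum_eq_single (((p, σ)) : FreqMomentum L M × Fin 2) (fun q _ hq => ?_) (fun h => absurd (Finset.mem_univ _) h)
    obtain ⟨p', σ'⟩ := q
    dsimp only
    rw [hminus p σ _ (fun h => hq (by simpa using h)), mul_zero]
  refine Finset.sum_congr rfl fun p _ => Finset.sum_congr rfl fun σ _ => ?_
  have e0 : ∑ p' : FreqMomentum L M, ∑ σ' : Fin 2, ℓ₁ p' *
        (kernel ℂ W 6 ![((p, σ), 1), ((p', σ'), 0), Z₀, Z₁, Z₂, Z₃] * kernel ℂ W 2 ![((p, σ), 0), ((p', σ'), 1)]) =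
      ℓ₁ p * kernel ℂ W 6 ![((p, σ), 1), ((p, σ), 0), Z₀, Z₁, Z₂, Z₃] * kernel ℂ W 2 ![((p, σ), 0), ((p, σ), 1)] := by
    simp_rw [← mul_assoc]
    exact hc0 p σ (fun p' σ' => ℓ₁ p' * kernel ℂ W 6 ![((p, σ), 1), ((p', σ'), 0), Z₀, Z₁, Z₂, Z₃])
  have e1 : ∑ p' : FreqMomentum L M, ∑ σ' : Fin 2, ℓ₁ p' *
        (kernel ℂ W 6 ![((p, σ), 0), ((p', σ'), 1), Z₀, Z₁, Z₂, Z₃] * kernel ℂ W 2 ![((p, σ), 1), ((p', σ'), 0)]) =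
      ℓ₁ p * kernel ℂ W 6 ![((p, σ), 0), ((p, σ), 1), Z₀, Z₁, Z₂, Z₃] * kernel ℂ W 2 ![((p, σ), 1), ((p, σ), 0)] := by
    simp_rw [← mul_assoc]
    exact hc1 p σ (fun p' σ' => ℓ₁ p' * kernel ℂ W 6 ![((p, σ), 0), ((p', σ'), 1), Z₀, Z₁, Z₂, Z₃])
  rw [e0, e1, kernel_six_swap01 W ((p, σ), 0) ((p, σ), 1), kernel_two_swap01 W ((p, σ), 0) ((p, σ), 1),
    kernel_six_eq_inv_mul_vertexFn β hβ W, kernel_two_eq_inv_mul_vertexFn β hβ W]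
  simp only [selfEnergy]
  ring

/-! ## §3 The assembled three-channel reading at general external pair frequencies -/

omit [NeZero M] in
/-- **`vertexFn_dblFold_bubble_pairKernel_of_conserving` — the three-channel reading at general external frequencies, any conserving carrier.**
For diagonal lines `C₁, C₂` (values `ℓ₁, ℓ₂`) and `W` even obeying the four conservation selection rules, at the pair labels
`Z(x,y) = ((ω′,k⃗′)↑+, (−ω′,Q−k⃗′)↓+, (−ω,Q−k⃗)↓−, (ω,k⃗)↑−)` (`x = (k⃗,ω)` in, `y = (k⃗′,ω′)` out — the label tuple of `klWickPairKernel`):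
`𝒱₄(dblFold(Δ_×(C₁)(Δ_×(C₂)(W⁰·W¹))))(Z) = 2·(βL²)⁻³·(PP + PHd − PHx − 2·S62)`. -/
theorem vertexFn_dblFold_bubble_pairKernel_of_conserving (hβ : β ≠ 0) (hW0 : W ∈ evenOdd ℂ 0)
    (hWq : ∀ (m : ℕ) (X : Fin m → HubbardFieldIdx L M), (∑ i, (if (X i).2 = 0 then (1 : ℤ) else -1)) ≠ 0 → kernel ℂ W m X = 0)
    (hWf : ∀ (m : ℕ) (X : Fin m → HubbardFieldIdx L M),
      (∑ i, (if (X i).2 = 0 then (1 : ℤ) else -1) * matsubaraInt M (X i).1.1.1) ≠ 0 → kernel ℂ W m X = 0)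
    (hWs : ∀ (m : ℕ) (X : Fin m → HubbardFieldIdx L M),
      (∑ i, (if (X i).2 = 0 then (1 : ℤ) else -1) * (if (X i).1.2 = 0 then 1 else 0)) ≠ 0 → kernel ℂ W m X = 0)
    (hWp : ∀ (m : ℕ) (X : Fin m → HubbardFieldIdx L M) (j : Fin 2),
      (∑ i, (if (X i).2 = 0 then (1 : ℤ) else -1) • (X i).1.1.2 j) ≠ 0 → kernel ℂ W m X = 0)
    {C₁ C₂ : Matrix (HubbardFieldIdx L M) (HubbardFieldIdx L M) ℂ} {ℓ₁ ℓ₂ : FreqMomentum L M → ℂ}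
    (h₁ : contr ℂ C₁ = diagContr L M ℓ₁) (h₂ : contr ℂ C₂ = diagContr L M ℓ₂) (Q : TorusSite 2 L) (x y : TorusSite 2 L × MatsubaraIdx M) :
    vertexFn L M β (dblFold ℂ (grassmannLaplacian ℂ (crossCov ℂ C₁) (grassmannLaplacian ℂ (crossCov ℂ C₂)
        (dblCopy ℂ 0 W * dblCopy ℂ 1 W)))) 4
        ![(((y.2, y.1), 0), 0), (((y.2.rev, Q - y.1), 1), 0), (((x.2.rev, Q - x.1), 1), 1), (((x.2, x.1), 0), 1)] =
      2 * ((((β * (L : ℝ) ^ 2 : ℝ) : ℂ)) ^ 3)⁻¹ *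
        ((∑ z : TorusSite 2 L × MatsubaraIdx M,
            (ℓ₂ (z.2, z.1) * ℓ₁ (z.2.rev, Q - z.1) + ℓ₁ (z.2, z.1) * ℓ₂ (z.2.rev, Q - z.1)) *
              (vertexFn L M β W 4
                  ![(((z.2, z.1), 0), 0), (((z.2.rev, Q - z.1), 1), 0), (((x.2.rev, Q - x.1), 1), 1), (((x.2, x.1), 0), 1)] *
                vertexFn L M β W 4
                  ![(((y.2, y.1), 0), 0), (((y.2.rev, Q - y.1), 1), 0), (((z.2.rev, Q - z.1), 1), 1), (((z.2, z.1), 0), 1)])) +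
          (∑ p : FreqMomentum L M, ∑ σ : Fin 2, ∑ p' : FreqMomentum L M,
            if matsubaraInt M p'.1 + matsubaraInt M y.2 = matsubaraInt M p.1 + matsubaraInt M x.2 ∧ p'.2 = p.2 + x.1 - y.1 then
              (ℓ₂ p * ℓ₁ p' + ℓ₁ p * ℓ₂ p') *
                (vertexFn L M β W 4 ![((p, σ), 1), ((p', σ), 0), (((y.2, y.1), 0), 0), (((x.2, x.1), 0), 1)] *
                  vertexFn L M β W 4 ![((p, σ), 0), ((p', σ), 1), (((y.2.rev, Q - y.1), 1), 0), (((x.2.rev, Q - x.1), 1), 1)])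
            else 0) -
          (∑ p : FreqMomentum L M, ∑ p' : FreqMomentum L M,
            if matsubaraInt M p'.1 + matsubaraInt M x.2 + matsubaraInt M y.2 + 1 = matsubaraInt M p.1 ∧ p'.2 = p.2 + Q - x.1 - y.1 then
              (ℓ₂ p * ℓ₁ p' + ℓ₁ p * ℓ₂ p') *
                (vertexFn L M β W 4 ![((p, 0), 1), ((p', 1), 0), (((y.2, y.1), 0), 0), (((x.2.rev, Q - x.1), 1), 1)] *
                  vertexFn L M β W 4 ![((p, 0), 0), ((p', 1), 1), (((y.2.rev, Q - y.1), 1), 0), (((x.2, x.1), 0), 1)])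
            else 0) -
          2 * ∑ p : FreqMomentum L M, ∑ σ : Fin 2, ℓ₁ p * ℓ₂ p *
            (vertexFn L M β W 6
                ![((p, σ), 0), ((p, σ), 1), (((y.2, y.1), 0), 0), (((y.2.rev, Q - y.1), 1), 0), (((x.2.rev, Q - x.1), 1), 1),
                  (((x.2, x.1), 0), 1)] *
              selfEnergy L M β W p σ)) := by
  have hL : (L : ℝ) ≠ 0 := Nat.cast_ne_zero.2 (NeZero.ne L)
  have hb : (((β * (L : ℝ) ^ 2 : ℝ) : ℂ)) ≠ 0 := by exact_mod_cast mul_ne_zero hβ (pow_ne_zero 2 hL)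
  obtain ⟨e4, e6, e2⟩ := vertexFn_consts_eq (L := L) β
  have hplus := kernel_two_plus_eq_zero_of_conserving W hWq hWf hWs hWp
  have hminus := kernel_two_minus_eq_zero_of_conserving W hWq hWf hWs hWp
  set Z₀ : HubbardFieldIdx L M := (((y.2, y.1), 0), 0) with hZ₀
  set Z₁ : HubbardFieldIdx L M := (((y.2.rev, Q - y.1), 1), 0) with hZ₁
  set Z₂ : HubbardFieldIdx L M := (((x.2.rev, Q - x.1), 1), 1) with hZ₂
  set Z₃ : HubbardFieldIdx L M := (((x.2, x.1), 0), 1) with hZ₃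
  have hv0 : (![Z₀, Z₁, Z₂, Z₃] : Fin 4 → HubbardFieldIdx L M) 0 = Z₀ := rfl
  have hv1 : (![Z₀, Z₁, Z₂, Z₃] : Fin 4 → HubbardFieldIdx L M) 1 = Z₁ := rfl
  have hv2 : (![Z₀, Z₁, Z₂, Z₃] : Fin 4 → HubbardFieldIdx L M) 2 = Z₂ := rfl
  have hv3 : (![Z₀, Z₁, Z₂, Z₃] : Fin 4 → HubbardFieldIdx L M) 3 = Z₃ := rfl
  rw [vertexFn_def, show (4 - 1 : ℕ) = 3 from rfl, kernel_dblFold_bubble_self ℂ C₁ C₂ hW0 ![Z₀, Z₁, Z₂, Z₃]]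
  simp only [hv0, hv1, hv2, hv3]
  rw [hZ₀, hZ₁, hZ₂, hZ₃, bubbleSum_pp_pairKernel_of_conserving β W hβ hWq hWf hWs hWp h₁ h₂ Q x y,
    bubbleSum_phDirect_pairKernel_of_conserving β W hβ hWq hWf hWs hWp h₁ h₂ Q x y,
    bubbleSum_phCrossed_pairKernel_of_conserving β W hβ hWq hWf hWs hWp h₁ h₂ Q x y,
    bubbleSum_sixTwo_of_twoLeg β W hβ hplus hminus h₁ h₂, e4, e6, e2]
  field_simp
  ring

end Generic

/-! ## §4 Instances -/

section Instances

variable {L M : ℕ} [NeZero L] [NeZero M] (β U μ : ℝ) (K : TrigPolyC4v)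

/-- **Grid carrier, general external frequencies**: `W = klWickAction … n` (p1's `vertexFn_dblFold_bubble_pairLabels` is the case `ω = ω′ = ω₀`). -/
theorem vertexFn_dblFold_bubble_pairKernel_klWickAction (hβ : β ≠ 0) {C₁ C₂ : Matrix (HubbardFieldIdx L M) (HubbardFieldIdx L M) ℂ}
    {ℓ₁ ℓ₂ : FreqMomentum L M → ℂ} (h₁ : contr ℂ C₁ = diagContr L M ℓ₁) (h₂ : contr ℂ C₂ = diagContr L M ℓ₂) (n : ℕ) (Q : TorusSite 2 L)
    (x y : TorusSite 2 L × MatsubaraIdx M) :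
    vertexFn L M β (dblFold ℂ (grassmannLaplacian ℂ (crossCov ℂ C₁) (grassmannLaplacian ℂ (crossCov ℂ C₂)
        (dblCopy ℂ 0 (klWickAction L M β U μ K n) * dblCopy ℂ 1 (klWickAction L M β U μ K n))))) 4
        ![(((y.2, y.1), 0), 0), (((y.2.rev, Q - y.1), 1), 0), (((x.2.rev, Q - x.1), 1), 1), (((x.2, x.1), 0), 1)] =
      2 * ((((β * (L : ℝ) ^ 2 : ℝ) : ℂ)) ^ 3)⁻¹ *
        ((∑ z : TorusSite 2 L × MatsubaraIdx M,
            (ℓ₂ (z.2, z.1) * ℓ₁ (z.2.rev, Q - z.1) + ℓ₁ (z.2, z.1) * ℓ₂ (z.2.rev, Q - z.1)) *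
              (klWickPairKernel L M β U μ K n Q x z * klWickPairKernel L M β U μ K n Q z y)) +
          (∑ p : FreqMomentum L M, ∑ σ : Fin 2, ∑ p' : FreqMomentum L M,
            if matsubaraInt M p'.1 + matsubaraInt M y.2 = matsubaraInt M p.1 + matsubaraInt M x.2 ∧ p'.2 = p.2 + x.1 - y.1 then
              (ℓ₂ p * ℓ₁ p' + ℓ₁ p * ℓ₂ p') *
                (vertexFn L M β (klWickAction L M β U μ K n) 4 ![((p, σ), 1), ((p', σ), 0), (((y.2, y.1), 0), 0), (((x.2, x.1), 0), 1)] *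
                  vertexFn L M β (klWickAction L M β U μ K n) 4
                    ![((p, σ), 0), ((p', σ), 1), (((y.2.rev, Q - y.1), 1), 0), (((x.2.rev, Q - x.1), 1), 1)])
            else 0) -
          (∑ p : FreqMomentum L M, ∑ p' : FreqMomentum L M,
            if matsubaraInt M p'.1 + matsubaraInt M x.2 + matsubaraInt M y.2 + 1 = matsubaraInt M p.1 ∧ p'.2 = p.2 + Q - x.1 - y.1 then
              (ℓ₂ p * ℓ₁ p' + ℓ₁ p * ℓ₂ p') *
                (vertexFn L M β (klWickAction L M β U μ K n) 4 ![((p, 0), 1), ((p', 1), 0), (((y.2, y.1), 0), 0), (((x.2.rev, Q - x.1), 1), 1)] *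
                  vertexFn L M β (klWickAction L M β U μ K n) 4
                    ![((p, 0), 0), ((p', 1), 1), (((y.2.rev, Q - y.1), 1), 0), (((x.2, x.1), 0), 1)])
            else 0) -
          2 * ∑ p : FreqMomentum L M, ∑ σ : Fin 2, ℓ₁ p * ℓ₂ p *
            (vertexFn L M β (klWickAction L M β U μ K n) 6
                ![((p, σ), 0), ((p, σ), 1), (((y.2, y.1), 0), 0), (((y.2.rev, Q - y.1), 1), 0), (((x.2.rev, Q - x.1), 1), 1),
                  (((x.2, x.1), 0), 1)] *
              klWickSelfEnergy L M β U μ K n p σ)) := by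
  simpa only [klWickPairKernel_apply, klWickSelfEnergy] using
    vertexFn_dblFold_bubble_pairKernel_of_conserving β (klWickAction L M β U μ K n) hβ (klw_wickAction_mem_evenOdd_zero L M β U μ K n)
      (fun _ _ h => kernel_klWickAction_eq_zero_of_charge β U μ K n h) (fun _ _ h => kernel_klWickAction_eq_zero_of_freq β U μ K n h)
      (fun _ _ h => kernel_klWickAction_eq_zero_of_spin β U μ K n h) (fun _ _ j h => kernel_klWickAction_eq_zero_of_momentum β U μ K n j h)
      h₁ h₂ Q x y

/-- **Real-cutoff carrier `𝒲_Λ`, general external frequencies** — with `(C₁, C₂) = (Ċ_Λ, D_Λ)` (`…WickScaleFlowLines`) this is the two-line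
class of the within-slice source (`…WickScaleFlowSource`), read at every pair of external frequencies. -/
theorem vertexFn_dblFold_bubble_pairKernel_wickActionR (hβ : β ≠ 0) {C₁ C₂ : Matrix (HubbardFieldIdx L M) (HubbardFieldIdx L M) ℂ}
    {ℓ₁ ℓ₂ : FreqMomentum L M → ℂ} (h₁ : contr ℂ C₁ = diagContr L M ℓ₁) (h₂ : contr ℂ C₂ = diagContr L M ℓ₂) (Λ : ℝ) (Q : TorusSite 2 L)
    (x y : TorusSite 2 L × MatsubaraIdx M) :
    vertexFn L M β (dblFold ℂ (grassmannLaplacian ℂ (crossCov ℂ C₁) (grassmannLaplacian ℂ (crossCov ℂ C₂)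
        (dblCopy ℂ 0 (gaussConv ℂ (hubbardCovBelowCT L M β μ 0 K Λ) (hubbardEffectiveActionCT L M β U μ 0 K Λ)) *
          dblCopy ℂ 1 (gaussConv ℂ (hubbardCovBelowCT L M β μ 0 K Λ) (hubbardEffectiveActionCT L M β U μ 0 K Λ)))))) 4
        ![(((y.2, y.1), 0), 0), (((y.2.rev, Q - y.1), 1), 0), (((x.2.rev, Q - x.1), 1), 1), (((x.2, x.1), 0), 1)] =
      2 * ((((β * (L : ℝ) ^ 2 : ℝ) : ℂ)) ^ 3)⁻¹ *
        ((∑ z : TorusSite 2 L × MatsubaraIdx M,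
            (ℓ₂ (z.2, z.1) * ℓ₁ (z.2.rev, Q - z.1) + ℓ₁ (z.2, z.1) * ℓ₂ (z.2.rev, Q - z.1)) *
              (vertexFn L M β (gaussConv ℂ (hubbardCovBelowCT L M β μ 0 K Λ) (hubbardEffectiveActionCT L M β U μ 0 K Λ)) 4
                  ![(((z.2, z.1), 0), 0), (((z.2.rev, Q - z.1), 1), 0), (((x.2.rev, Q - x.1), 1), 1), (((x.2, x.1), 0), 1)] *
                vertexFn L M β (gaussConv ℂ (hubbardCovBelowCT L M β μ 0 K Λ) (hubbardEffectiveActionCT L M β U μ 0 K Λ)) 4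
                  ![(((y.2, y.1), 0), 0), (((y.2.rev, Q - y.1), 1), 0), (((z.2.rev, Q - z.1), 1), 1), (((z.2, z.1), 0), 1)])) +
          (∑ p : FreqMomentum L M, ∑ σ : Fin 2, ∑ p' : FreqMomentum L M,
            if matsubaraInt M p'.1 + matsubaraInt M y.2 = matsubaraInt M p.1 + matsubaraInt M x.2 ∧ p'.2 = p.2 + x.1 - y.1 then
              (ℓ₂ p * ℓ₁ p' + ℓ₁ p * ℓ₂ p') *
                (vertexFn L M β (gaussConv ℂ (hubbardCovBelowCT L M β μ 0 K Λ) (hubbardEffectiveActionCT L M β U μ 0 K Λ)) 4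
                    ![((p, σ), 1), ((p', σ), 0), (((y.2, y.1), 0), 0), (((x.2, x.1), 0), 1)] *
                  vertexFn L M β (gaussConv ℂ (hubbardCovBelowCT L M β μ 0 K Λ) (hubbardEffectiveActionCT L M β U μ 0 K Λ)) 4
                    ![((p, σ), 0), ((p', σ), 1), (((y.2.rev, Q - y.1), 1), 0), (((x.2.rev, Q - x.1), 1), 1)])
            else 0) -
          (∑ p : FreqMomentum L M, ∑ p' : FreqMomentum L M,
            if matsubaraInt M p'.1 + matsubaraInt M x.2 + matsubaraInt M y.2 + 1 = matsubaraInt M p.1 ∧ p'.2 = p.2 + Q - x.1 - y.1 then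
              (ℓ₂ p * ℓ₁ p' + ℓ₁ p * ℓ₂ p') *
                (vertexFn L M β (gaussConv ℂ (hubbardCovBelowCT L M β μ 0 K Λ) (hubbardEffectiveActionCT L M β U μ 0 K Λ)) 4
                    ![((p, 0), 1), ((p', 1), 0), (((y.2, y.1), 0), 0), (((x.2.rev, Q - x.1), 1), 1)] *
                  vertexFn L M β (gaussConv ℂ (hubbardCovBelowCT L M β μ 0 K Λ) (hubbardEffectiveActionCT L M β U μ 0 K Λ)) 4
                    ![((p, 0), 0), ((p', 1), 1), (((y.2.rev, Q - y.1), 1), 0), (((x.2, x.1), 0), 1)])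
            else 0) -
          2 * ∑ p : FreqMomentum L M, ∑ σ : Fin 2, ℓ₁ p * ℓ₂ p *
            (vertexFn L M β (gaussConv ℂ (hubbardCovBelowCT L M β μ 0 K Λ) (hubbardEffectiveActionCT L M β U μ 0 K Λ)) 6
                ![((p, σ), 0), ((p, σ), 1), (((y.2, y.1), 0), 0), (((y.2.rev, Q - y.1), 1), 0), (((x.2.rev, Q - x.1), 1), 1),
                  (((x.2, x.1), 0), 1)] *
              selfEnergy L M β (gaussConv ℂ (hubbardCovBelowCT L M β μ 0 K Λ) (hubbardEffectiveActionCT L M β U μ 0 K Λ)) p σ)) :=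
  vertexFn_dblFold_bubble_pairKernel_of_conserving β _ hβ (klws_wickActionR_mem_evenOdd_zero β U μ K Λ)
    (fun _ _ h => kernel_wickActionR_eq_zero_of_charge β U μ K Λ h) (fun _ _ h => kernel_wickActionR_eq_zero_of_freq β U μ K Λ h)
    (fun _ _ h => kernel_wickActionR_eq_zero_of_spin β U μ K Λ h) (fun _ _ j h => kernel_wickActionR_eq_zero_of_momentum β U μ K Λ j h)
    h₁ h₂ Q x y

end Instances

end Summit.HubbardSuperconductivity.HubbardSuperconductivity.Theorems.KLRegimeWick

end
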